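import Literature.AlgebraicGeometry.Hu2025.Statements.S04ModelV.R105aGoverning
import Mathlib.RingTheory.Smooth.Basic
import HarnessLib

/-!
# Hu 2025 (arXiv:2507.21400v1), §4.6 (chunks p0032 l.51 – p0033 l.6; PDF p.76 l.3 – p.77 l.34) — the ϖ-, ϱ- and 𝔏-DIVISORS of `𝓡`
# (Def. 4.53), the STANDARD CHARTS OF `𝓡_[k]` (Props 4.54–4.56) and the chart displays (4.48)–(4.50): the chart equations of
# `𝒱_[k] ∩ 𝔙`, `𝒱 ∩ 𝔙` (row 105, file b `R105bCharts.lean`; file a `R105aGoverning.lean` = §4.5).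
# STATEMENTS-FIRST typing (rung M-Hu-min, D-0089), filed by the row-105 typer of record res-type-079 (director's 08:00Z «M-Hu-min OPEN» line;
# PARTITION-HU §3c.1 pointer 105 → 079). Provenance: pre-draft bodies v1–v7 by res-type-079 (HOME/plan/tools/res-type-079/hu/README-hu105-IGOV.md;
# body of record v7 sha16 fe0122c04f7f11c9); T9 LOCATOR AUDIT against both layers (chunk text of record p0030/p0032/p0033, 1-based lines as
# PARTITION-HU §3 cites them; PDF text lit/res-lit-6/hu25/text/): every docstring carries «chunk …; PDF p.N l.a–b» with the PRINTED equation
# numbers (4.34), (4.40), (4.48)–(4.50) (cross-checked with res-type-044 README-hu104); locators re-read before filing. Lane-B pre-read notes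
# applied before filing (res-ref-b12 2026-08-27T06:59Z / 07:08Z): N105-2 (`Prop4_54` docstring: items (1)–(3) are a model-consistency statement
# in this rendering), N105-3 (`Prop4_54_smooth` binds `[Finite σ]`). Universe-polymorphic (`k : Type u`, `σ : Type v`, `T : Type w`,
# `𝔗 : Type x`). On top of the I-R file `S04ModelV/R103aModelR.lean` (row 103) and the I-GOV file `R105aGoverning.lean` (this row), imported.
# Row 104's `R104bEquationsOfV` (res-type-044) imports THIS file for `StdChart0` / `dehomog0` / `LambdaStar` / `ChartRing0` and aliases
# `Def4_45 := StdChart0` — do not rename.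

**Status of the source (D-0012): UNREFEREED PREPRINT UNDER ADJUDICATION.** Nothing from the preprint is asserted; printed claims
are `def … : Prop` CANDIDATES `[claim: Hu2025, status: under-review]`. No proofs, no `sorry`, no `instance`, no notation.
NUMBERING: PRINTED (PDF) item number = chunk number + 1 in §4 (PARTITION-HU §0 erratum); both in every docstring.

## Carriers (PARTITION-HU §1: chart-local commutative algebra)
* A standard chart of `𝓡_Φ = 𝕌 × Π_{F ∈ Φ} ℙ_F` (Def. 4.45 ‹chunk 4.44›, row 104) is a CHOICE `o : 𝔗 → T` of one term per block
  (`rel (o F) = F`; only `F ∈ Φ` matters): the affine open `(x_{o F} ≡ 1, F ∈ Φ)`. Its coordinate ring is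
  `ChartRing0 σ 𝔙 k = MvPolynomial (σ ⊕ Λ^⋆) k`, `Λ^⋆ = {t : rel t ∈ Φ, t ≠ o (rel t)}` (chunk p0030 l.120–122; PDF p.71 l.3–10),
  and the de-homogenisation `dehomog0 : R → ChartRing0` sends `x_{o F} ↦ 1`, `x_t ↦ x_{𝔙,t}` (`t ∈ Λ^⋆`), `x_u ↦ x_{𝔙,u}`, and the
  ϱ-variables of blocks outside `Φ` (not functions on `𝓡_Φ`) to `0` (junk; they do not occur in `R_Φ`).
* «`𝒱_Φ ∩ 𝔙`, as a closed subscheme of `𝔙`, is defined by the relations E» is typed as the IDEAL IDENTITY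
  `(modelVIdeal rel mono 𝓕 Φ).map dehomog0 = Ideal.span (dehomog0 '' E)` in `ChartRing0` (the chart piece of the closed subscheme
  of the multi-projective `𝓡_Φ` cut out by the multi-homogeneous ideal `modelVIdeal` is its de-homogenisation).
* `𝓑^𝔯𝔟_Φ` (Def. 4.32 ‹4.31›, row 104's `rbBinomials rel mono Φ`) and the primary relations `F̄ : 𝔗 → R_0` (row 104's `primaryBar sgn` /
  row 101's `primaryRelBar` through row 103's instantiation) are PARAMETERS `Brb`, `Fbar` here. Universe-polymorphic like I-R / I-GOV
  (`k : Type u`, `σ : Type v`, `T : Type w`, `𝔗 : Type x`; Mathlib's `Algebra.Smooth R A` allows `R`, `A` in different universes).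
-/

noncomputable section

namespace Literature.AlgebraicGeometry.Hu2025.Statements.S04ModelV

open MvPolynomial

section Charts

universe u v w x

variable {k : Type u} [CommRing k] {σ : Type v} {T : Type w} {𝔗 : Type x}
variable (rel : T → 𝔗) (mono : T → (σ →₀ ℕ)) (head : 𝔗 → T) (sgn : T → ℤ)

/-! ## §4.6 Def. 4.53 ‹chunk Definition 4.52› — ϖ-, ϱ- and 𝔏-divisors of `𝓡` (chunk p0032 l.51–83; PDF p.76 l.3–18) -/

/-- **Hu 2025, Def. 4.53, the ϖ-divisor `X_u := (x_u = 0) ⊂ 𝓡`** (chunk p0032 l.55–65; PDF p.76 l.4–10), verbatim: «Consider the scheme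
`𝓡 = 𝕌 × Π_{F̄ ∈ 𝓕} ℙ_F`. … For any `u ∈ 𝕀_{3,n} ∖ (123)`, we set `X_u := (x_u = 0) ⊂ 𝓡`. We call `X_u` the Plücker divisor, in short, the
ϖ-divisor, of `𝓡` associated with `u`.» — carried by its equation `x_u ∈ R` (= I-R's `varpiVar`; the scheme `𝓡` itself is row 110's
level). PARTITION-HU §3 lists this decl as `piDivisor`; named `varpiDivisor` after I-R's `varpiVar` (ϖ = `\varpi`).
[claim: Hu2025, status: under-review]
STATUS: candidate statement under adjudication (D-0012/D-0089); not asserted. -/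
abbrev varpiDivisor (s : σ) : ModelRing σ T k := varpiVar s

/-- **Hu 2025, Def. 4.53, the ϱ-divisor `X_{(u,v)} := (x_{(u,v)} = 0)`** (chunk p0032 l.67–74; PDF p.76 l.11–14), `(u,v) ∈ Λ_𝓕`: «We call
`X_{(u,v)}` the ϱ-divisor corresponding to `(u,v)`.» — by its equation (= I-R's `rhoVar`). [claim: Hu2025, status: under-review]
STATUS: candidate statement under adjudication (D-0012/D-0089); not asserted. -/
abbrev rhoDivisor (t : T) : ModelRing σ T k := rhoVar t

/-- **Hu 2025, Def. 4.53, the 𝔏-divisor `D_{L_F} := (L_F = 0)`** (chunk p0032 l.76–83; PDF p.76 l.15–18), `F̄ ∈ 𝓕`: «We call `D_{L_F}` the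
𝔏-divisor corresponding to `F`.» — by its equation `L_F`. [claim: Hu2025, status: under-review]
STATUS: candidate statement under adjudication (D-0012/D-0089); not asserted. -/
abbrev LDivisor [Fintype T] [DecidableEq 𝔗] (F : 𝔗) : ModelRing σ T k := linPl (k := k) (σ := σ) rel sgn F

/-- **Hu 2025, Def. 4.53, the sets `𝓓_ϖ`, `𝓓_ϱ`, `𝓓_𝔏`** (chunk p0032 l.65, l.74, l.83; PDF p.76 l.9–10, l.13–14, l.17–18: «We let `𝓓_ϖ` be
the set of all ϖ-divisors on the scheme `𝓡`», «`𝓓_ϱ` … the set of all ϱ-divisors of `𝓡`», «`𝓓_𝔏` … the set of all 𝔏-divisors of `𝓡`»)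
— as the sets of their equations in `R`. [claim: Hu2025, status: under-review]
STATUS: candidate statement under adjudication (D-0012/D-0089); not asserted. -/
def Def4_53 [Fintype T] [DecidableEq 𝔗] : Set (ModelRing σ T k) × Set (ModelRing σ T k) × Set (ModelRing σ T k) :=
  (Set.range (varpiVar (k := k) (σ := σ) (T := T)), Set.range (rhoVar (k := k) (σ := σ) (T := T)),
   Set.range (linPl (k := k) (σ := σ) rel sgn))


/-- **Hu 2025, Def. 4.45 ‹chunk Definition 4.44›, a standard chart of `𝓡_{[k]}`** (chunk p0030 l.81–91; PDF p.70 l.20–29), verbatim: «Fix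
`k ∈ [Υ]`. For every `F̄_i ∈ 𝓕` with `i ∈ [k]`, choose and fix an arbitrary element `s_{F_i,o} ∈ S_{F_i}`. Then, the scheme `𝓡_{[k]}` is
covered by the affine open charts of the form `𝕌 × Π_{i ∈ [k]} (x_{(u_{s_{F_i,o}}, v_{s_{F_i,o}})} ≡ 1) ⊂ 𝓡_{[k]} = 𝕌 × Π_{i ∈ [k]} ℙ_{F_i}`. We
call such an affine open subset a standard chart of `𝓡_{[k]}`, often denoted by 𝔙.» — the chart DATUM: a choice of one term per block
(row 104 owns `Def4_45`, an alias of this structure, and `StdChart0.LiesOver`; PARTITION-HU §3 row 105 lists `StdChart0` for Prop.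
4.54's «standard chart (Definition 4.45)»). [claim: Hu2025, status: under-review]
STATUS: candidate statement under adjudication (D-0012/D-0089); not asserted. -/
structure StdChart0 (rel : T → 𝔗) (Φ : Set 𝔗) where
  /-- the chosen term `s_{F,o}` of each block (only `F ∈ Φ` is used) -/
  o : 𝔗 → T
  /-- `s_{F,o} ∈ S_F` -/
  rel_o : ∀ F ∈ Φ, rel (o F) = F

variable {rel}

/-- **Hu 2025, (4.34) `Λ^o_{[k]}`** (chunk p0030 l.105–111; PDF p.70 l.41–45), verbatim: «Note that the standard chart 𝔙 of `𝓡_{[k]}` in the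
above definition is uniquely indexed by the set `Λ^o_{[k]} = {(u_{s_{F_i,o}}, v_{s_{F_i,o}}) ∈ Λ_{F_i} ∣ i ∈ [k]}`» — the chosen terms.
[claim: Hu2025, status: under-review]
STATUS: candidate statement under adjudication (D-0012/D-0089); not asserted. -/
def StdChart0.LambdaO {Φ : Set 𝔗} (𝔙 : StdChart0 rel Φ) : Set T := 𝔙.o '' Φ

/-- **Hu 2025, `Λ^⋆_{[k]} = (⋃_{i ∈ [k]} Λ_{F_i}) ∖ Λ^o_{[k]}`** (chunk p0030 l.120–122; PDF p.71 l.3–10; «`Λ^o_𝓕 := Λ^o_{𝓕[Υ]}` and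
`Λ^⋆_𝓕 := Λ^⋆_{𝓕[Υ]}`», chunk l.124–126; PDF p.71 l.11–16) — the indices of the de-homogenised ϱ-variables of the chart, as a subtype
(it indexes chart variables). [claim: Hu2025, status: under-review]
STATUS: candidate statement under adjudication (D-0012/D-0089); not asserted. -/
def StdChart0.LambdaStar {Φ : Set 𝔗} (𝔙 : StdChart0 rel Φ) : Type w := {t : T // rel t ∈ Φ ∧ t ≠ 𝔙.o (rel t)}

/-- **Hu 2025, Prop. 4.54 ‹chunk Proposition 4.53›, the free variables of a standard chart** (chunk p0032 l.95–99; PDF p.76 l.27–29),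
verbatim: «It comes equipped with the set of free variables `Var_𝔙 = {x_{𝔙,w}, x_{𝔙,(u,v)} ∣ w ∈ 𝕀_{3,n} ∖ (123), (u,v) ∈ Λ^⋆_{[k]}}`» —
the chart's coordinate ring `𝕜[Var_𝔙]`. [claim: Hu2025, status: under-review]
STATUS: candidate statement under adjudication (D-0012/D-0089); not asserted. -/
abbrev ChartRing0 (σ : Type v) {Φ : Set 𝔗} (𝔙 : StdChart0 rel Φ) (k : Type u) [CommRing k] : Type (max (max v w) u) :=
  MvPolynomial (σ ⊕ 𝔙.LambdaStar) k

/-- **De-homogenisation at the standard chart** (proof of Prop. 4.54, chunk p0032 l.115–125; PDF p.77 l.3–6: «Recall that `𝕌 = (p_{(123)} ≡ 1)`.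
Then, we let `x_{𝔙,w} = x_w` for all `w ∈ 𝕀_{3,n} ∖ (123)`. … Upon setting `x_{(u_{s_{F_i,0}}, v_{s_{F_i,0}})} ≡ 1`, we let
`x_{𝔙,(u_s,v_s)} = x_{(u_s,v_s)}` be the de-homogenization of `x_{(u_s,v_s)}` for all `s ∈ S_{F_i} ∖ s_{F_i,o}`») — the `𝕜`-algebra map
`R → 𝕜[Var_𝔙]`: `x_u ↦ x_{𝔙,u}`, `x_{o F} ↦ 1` (`F ∈ Φ`), `x_t ↦ x_{𝔙,t}` (`t ∈ Λ^⋆`), and `x_t ↦ 0` for blocks outside `Φ` (junk: such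
variables are not in `R_Φ`). Plumbing. [claim: Hu2025, status: under-review]
STATUS: candidate statement under adjudication (D-0012/D-0089); not asserted. -/
def StdChart0.dehomog0 {Φ : Set 𝔗} (𝔙 : StdChart0 rel Φ) : ModelRing σ T k →ₐ[k] ChartRing0 σ 𝔙 k :=
  haveI := Classical.propDecidable
  aeval (Sum.elim (fun s => X (Sum.inl s)) fun t =>
    if h : rel t ∈ Φ ∧ t ≠ 𝔙.o (rel t) then X (Sum.inr ⟨t, h⟩) else if rel t ∈ Φ then 1 else 0)

/-- **Hu 2025, (4.49), the de-homogenised linearized relation `L_{𝔙,F}`** (Prop. 4.54, chunk p0032 l.101; PDF p.76 l.30: «and the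
de-homogenized linearized Plücker relations `L_{𝔙,F}` for all `F̄ ∈ 𝓕`»; display (4.49), chunk p0032 l.162–163; PDF p.77 l.25–29:
«`L_{𝔙,F} : Σ_{s ∈ S_F} sgn(s) x_{𝔙,(u_s,v_s)}`», with `x_{𝔙, o F} = 1`). [claim: Hu2025, status: under-review]
STATUS: candidate statement under adjudication (D-0012/D-0089); not asserted. -/
def StdChart0.linPlChart [Fintype T] [DecidableEq 𝔗] {Φ : Set 𝔗} (𝔙 : StdChart0 rel Φ) (F : 𝔗) : ChartRing0 σ 𝔙 k :=
  𝔙.dehomog0 (linPl (k := k) (σ := σ) rel sgn F)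

/-- **Hu 2025, (4.49)** — numbered alias of `StdChart0.linPlChart`. [claim: Hu2025, status: under-review]
STATUS: candidate statement under adjudication (D-0012/D-0089); not asserted. -/
abbrev Eq4_49 [Fintype T] [DecidableEq 𝔗] {Φ : Set 𝔗} (𝔙 : StdChart0 rel Φ) (F : 𝔗) : ChartRing0 σ 𝔙 k :=
  𝔙.linPlChart (k := k) sgn F

/-- **Hu 2025, Prop. 4.54 ‹chunk Proposition 4.53›, items (1)–(3)** (chunk p0032 l.102–111; PDF p.76 l.30–35), verbatim: «such that on the
standard chart 𝔙, we have (1) the divisor `X_w ∩ 𝔙` is defined by `(x_{𝔙,w} = 0)` for every `w ∈ 𝕀_{3,n} ∖ (123)`; (2) the divisor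
`X_{(u,v)} ∩ 𝔙` is defined by `(x_{𝔙,(u,v)} = 0)` for every `(u,v) ∈ Λ^⋆_{[k]}`. (3) the divisor `D_{L_F} ∩ 𝔙` is defined by `(L_{𝔙,F} = 0)`
for every `F̄ ∈ 𝓕`.» (the chunk prints the three items as bullets, the PDF numbers them (1)–(3)) — as the identities «de-homogenised
divisor equation = the named chart equation» (up to the unit ideal they generate). MODEL NOTE (lane-B pre-read N105-2): in this
rendering the divisors are carried BY their equations (Def. 4.53) and the chart variables are named after them, so items (1)–(3) hold
for every standard chart by construction (`dehomog0` sends `varpiVar s` to `X (inl s)` and `rhoVar t` to `X (inr t)` definitionally, and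
`linPlChart F := dehomog0 (linPl F)` makes (3) `rfl`): a model-consistency statement, matching the print's «straightforward to check»; the
content of Prop. 4.54 beyond naming is the smoothness clause `Prop4_54_smooth`. [claim: Hu2025, status: under-review]
STATUS: candidate statement under adjudication (D-0012/D-0089); not asserted. -/
def Prop4_54 [Fintype T] [DecidableEq 𝔗] (Φ : Set 𝔗) (𝔙 : StdChart0 rel Φ) : Prop :=
  (∀ s : σ, Ideal.span {𝔙.dehomog0 (varpiVar (k := k) (T := T) s)} = Ideal.span {(X (Sum.inl s) : ChartRing0 σ 𝔙 k)}) ∧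
  (∀ t : 𝔙.LambdaStar, Ideal.span {𝔙.dehomog0 (rhoVar (k := k) (σ := σ) t.1)} = Ideal.span {(X (Sum.inr t) : ChartRing0 σ 𝔙 k)}) ∧
  (∀ F ∈ Φ, Ideal.span {𝔙.dehomog0 (linPl (k := k) (σ := σ) rel sgn F)} = Ideal.span {𝔙.linPlChart (k := k) sgn F})

/-- **Hu 2025, Prop. 4.54, «In particular, all the above divisors are smooth.»** (chunk p0032 l.113; PDF p.76 l.36) — typed for the three
families as smoothness over `𝕜` of the hypersurface rings `𝕜[Var_𝔙]/(equation)` (Mathlib `Algebra.Smooth` = formally smooth AND finitely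
presented), over a FINITE ϖ-index type `σ` (binder `[Finite σ]`, lane-B pre-read note N105-3: the print lives on the finite platform
`𝕀_{3,n} ∖ (123)`; for an infinite `σ` the quotient of `𝕜[Var_𝔙]` by one variable is not finitely presented and the clause would fail for
that reason alone). [claim: Hu2025, status: under-review]
STATUS: candidate statement under adjudication (D-0012/D-0089); not asserted. -/
def Prop4_54_smooth [Finite σ] [Fintype T] [DecidableEq 𝔗] (Φ : Set 𝔗) (𝔙 : StdChart0 rel Φ) : Prop :=
  (∀ s : σ, Algebra.Smooth k (ChartRing0 σ 𝔙 k ⧸ Ideal.span {(X (Sum.inl s) : ChartRing0 σ 𝔙 k)})) ∧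
  (∀ t : 𝔙.LambdaStar, Algebra.Smooth k (ChartRing0 σ 𝔙 k ⧸ Ideal.span {(X (Sum.inr t) : ChartRing0 σ 𝔙 k)})) ∧
  (∀ F ∈ Φ, Algebra.Smooth k (ChartRing0 σ 𝔙 k ⧸ Ideal.span {𝔙.linPlChart (k := k) sgn F}))

/-- **Hu 2025, Prop. 4.55 ‹chunk Proposition 4.54›** (chunk p0032 l.128–139; PDF p.77 l.8–12), verbatim: «Let the notation be as in
Propsotion [sic] 4.54. Then, the scheme `𝒱_{[k]} ∩ 𝔙`, as a closed subscheme of 𝔙 is defined by the following relations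
`𝓑_{𝔙,[k]}, {L_{𝔙,F_i}, i ∈ [k]}, {F̄_j, k < j ≤ Υ}`. where the equations of `𝓑_{𝔙,[k]}` and `{L_{𝔙,F_i}, i ∈ [k]}` are the
de-homogenizations of the equations of `𝓑_{[k]}` (see (4.40)) and `{L_{F_i}, i ∈ [k]}` with respect to the chart 𝔙.» (proof, chunk
l.141–142; PDF p.77 l.13–14: «This follows directly from Lemma 4.46») — as the ideal identity in `𝕜[Var_𝔙]`; `[k] ↦ Φ`, `𝓑_Φ = BIn Brb Φ`
of (4.40) with the 𝔯𝔟-binomials `Brb` (row 104's `𝓑^𝔯𝔟_Φ`) and the primary relations `Fbar : 𝔗 → R_0` as parameters.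
[claim: Hu2025, status: under-review]
STATUS: candidate statement under adjudication (D-0012/D-0089); not asserted. -/
def Prop4_55 [Fintype T] [DecidableEq 𝔗] (Fbar : 𝔗 → R0 σ k) (Brb : Set (ModelRing σ T k)) (Φ : Set 𝔗)
    (𝔙 : StdChart0 rel Φ) : Prop :=
  (modelVIdeal (k := k) rel mono (Set.range Fbar) Φ).map 𝔙.dehomog0 =
    Ideal.span (𝔙.dehomog0 '' (wpBinomials (k := k) rel mono Φ ∪ Brb ∪ (linPl (k := k) (σ := σ) rel sgn) '' Φ) ∪
      (fun F => 𝔙.dehomog0 (toModel (T := T) (Fbar F))) '' Φᶜ)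

/-- **Hu 2025, Prop. 4.56 ‹chunk Proposition 4.55›** (chunk p0032 l.145–154; PDF p.77 l.16–20), verbatim: «As a special case of the above
proposition, we have Proposition 4.56. Let the notation be as in Proposition 4.55 for `k = Υ`. Then, the scheme `𝒱 ∩ 𝔙`, as a closed
subscheme of the chart 𝔙 of `𝓡`, is defined by `𝓑_𝔙 ⊔ {L_{𝔙,F_i}, i ∈ [Υ]}` where `𝓑 = 𝓑^gov ⊔ 𝓑^ngv ⊔ 𝓑^𝔯𝔟`.» — `Φ = univ`;
`𝓑^gov ⊔ 𝓑^ngv` through I-GOV's `BgovIn`/`BngvIn` ((4.43)/(4.44)), `𝓑^𝔯𝔟 = Brb`. [claim: Hu2025, status: under-review]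
STATUS: candidate statement under adjudication (D-0012/D-0089); not asserted. -/
def Prop4_56 [Fintype T] [DecidableEq 𝔗] (Fbar : 𝔗 → R0 σ k) (Brb : Set (ModelRing σ T k))
    (𝔙 : StdChart0 rel (Set.univ : Set 𝔗)) : Prop :=
  (modelVIdeal (k := k) rel mono (Set.range Fbar) Set.univ).map 𝔙.dehomog0 =
    Ideal.span (𝔙.dehomog0 '' (BgovIn (k := k) rel mono head Set.univ ∪ BngvIn (k := k) rel mono head Set.univ ∪ Brb ∪
      Set.range (linPl (k := k) (σ := σ) rel sgn)))

/-- **Hu 2025, (4.48), `B_{𝔙,(s_F,s)}`** (chunk p0032 l.156–160; PDF p.77 l.21–24), verbatim: «Here, it is worth to mention that the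
governing relations in the proposition are `B_{𝔙,(s_F,s)} : x_{𝔙,(u_s,v_s)} x_{𝔙,u_F} − x_{𝔙,(m,u_F)} x_{𝔙,u_s} x_{𝔙,v_s}`, `∀ s ∈ S_F ∖ s_F`»
— the de-homogenised governing binomial (4.41). [claim: Hu2025, status: under-review]
STATUS: candidate statement under adjudication (D-0012/D-0089); not asserted. -/
def StdChart0.govBinomialChart {Φ : Set 𝔗} (𝔙 : StdChart0 rel Φ) (F : 𝔗) (s : T) : ChartRing0 σ 𝔙 k :=
  𝔙.dehomog0 (govBinomial (k := k) mono head F s)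

/-- **Hu 2025, (4.48)** — numbered alias of `StdChart0.govBinomialChart`. [claim: Hu2025, status: under-review]
STATUS: candidate statement under adjudication (D-0012/D-0089); not asserted. -/
abbrev Eq4_48 {Φ : Set 𝔗} (𝔙 : StdChart0 rel Φ) (F : 𝔗) (s : T) : ChartRing0 σ 𝔙 k :=
  𝔙.govBinomialChart (k := k) mono head F s

/-- **Hu 2025, (4.50), `B_{𝔙,(s,t)}`** (chunk p0033 l.1–6; PDF p.77 l.30–34), verbatim (PDF p.77 l.30, a clause the chunk layer lacks): «The
non-governing binomial relations of ϱ-degree 1 in the proposition are `B_{𝔙,(s,t)} : x_{𝔙,(u_s,v_s)} x_{𝔙,u_t} x_{𝔙,v_t} −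
x_{𝔙,(u_t,v_t)} x_{𝔙,u_s} x_{𝔙,v_s}`, `∀ s, t ∈ S_F ∖ s_F` for all `F̄ ∈ 𝓕`.» — the de-homogenised non-governing binomial (here WITHOUT the
stray factor of (4.42): the chart display is the corrected pattern, cf. `ngvBinomial_ours`). [claim: Hu2025, status: under-review]
STATUS: candidate statement under adjudication (D-0012/D-0089); not asserted. -/
def StdChart0.ngvBinomialChart {Φ : Set 𝔗} (𝔙 : StdChart0 rel Φ) (s t : T) : ChartRing0 σ 𝔙 k :=
  𝔙.dehomog0 (wpBinomial (k := k) mono s t)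

/-- **Hu 2025, (4.50)** — numbered alias of `StdChart0.ngvBinomialChart`. [claim: Hu2025, status: under-review]
STATUS: candidate statement under adjudication (D-0012/D-0089); not asserted. -/
abbrev Eq4_50 {Φ : Set 𝔗} (𝔙 : StdChart0 rel Φ) (s t : T) : ChartRing0 σ 𝔙 k :=
  𝔙.ngvBinomialChart (k := k) mono s t

end Charts

end Literature.AlgebraicGeometry.Hu2025.Statements.S04ModelV

end
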